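import Literature.Probability.RandomPlanarGeometry.SAWTriangularBridgeDivergence
import Literature.Probability.Process.RenewalTheorem
import HarnessLib

/-!
# An explicit tail bound for Kesten's irreducible-bridge law on the triangular lattice:
# `1 − Σ_{k ≤ m} λ_k(𝕋) μ(𝕋)^{-k} ≤ 1/(1 + ½ log(m/μ(𝕋)))`

Topic `Literature/Probability/RandomPlanarGeometry` (continues `SAWTriangularBridgeRenewal.lean` /
`SAWTriangularBridgeDivergence.lean`: the brick-frame bridges `b_n(𝕋) = brickBridgeCount n` and irreducible bridges
`λ_n(𝕋) = brickIrreducibleBridgeCount n` of `𝕋`, the renewal equation (4.2.2) `brickBridgeCount_eq_sum_range`,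
the partial sums `Σ λ_k μ^{-k} ≤ 1` (`sum_brickIrreducibleBridgeCount_div_pow_le_one`), Kesten's relation
`hasSum_brickIrreducibleBridgeCount_div_pow`, and (3.1.14) in finite form `half_log_le_sum_brickBridgeCount`).
Source: N. Madras, G. Slade, *The Self-Avoiding Walk* (1993): §4.2, eq. (4.2.2)–(4.2.5) (pp. 90–91) (Kesten's
relation `Σ_N λ_N μ^{-N} = 1`, so that `λ_N μ^{-N}` is a probability law on irreducible bridges — there for `ℤ^d`);
Appendix B, eq. (B.5) (the conservation law `Σ_{k ≤ n} r_k u_{n-k} = 1` of a renewal sequence, `r_k` the tail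
sums); §3.1, eq. (3.1.14) (p. 62) (`Σ_{n ≤ N} b_n μ^{-n} ≥ ½ log(N/μ)` from (3.1.13)). The statement below is the
triangular-lattice twin of the tree's `Zd.kestenTail_le_inv_log` (`SAWBridgeRatioRate.lean`, every `ℤ^d`) and
`HexBW.kestenTail_le_inv_log` (`HexSAWBrickWallRatioOneRate.lean`, honeycomb, brick-wall frame), with the same
proof: (B.5) with antitone tails gives `r_m · Σ_{n ≤ m} u_n ≤ 1`, and `Σ_{n ≤ m} u_n = 1 + B⁺_m(1/μ) ≥ 1 + ½ log(m/μ)`.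

Printed status: no tail bound for the irreducible-bridge length law is printed for any lattice (M–S §4.2 treats
the critical renewal qualitatively; Kesten 1963 §4); for `𝕋` the renewal identities themselves are only asserted in
the enumeration literature (Jensen 2004 §2). Here: `brickIrreducibleBridgeTail_le_inv_log`, and the probabilistic
reading `brickIrreducibleBridgeTail_eq_tsum` (the left side IS the tail `Σ_{k > m} λ_k μ^{-k}` of Kesten's law, by
Kesten's relation on `𝕋`).
-/

noncomputable section

open Finset Filter Topology
open scoped BigOperators

namespace Literature.Probability.RandomPlanarGeometry.SAW

/-- `Σ_{1 ≤ k ≤ n} g k = Σ_{k < n} g (k+1)`. [cite: MadrasSlade1993, Appendix B] -/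
private theorem sum_Icc_one_eq_sum_range_tri (g : ℕ → ℝ) (n : ℕ) :
    ∑ k ∈ Icc 1 n, g k = ∑ k ∈ range n, g (k + 1) := by
  induction n with
  | zero => simp
  | succ n ih => rw [Finset.sum_Icc_succ_top (by omega), ih, Finset.sum_range_succ]

/-- **The explicit Kesten tail for bridges of the triangular lattice** (brick frame):
`1 − Σ_{1 ≤ k ≤ m} λ_k(𝕋) μ(𝕋)^{-k} ≤ 1/(1 + ½ log(m/μ(𝕋)))` for `m ≥ 1` with `μ(𝕋) ≤ m`: the conservation law
(B.5) for the renewal sequence `u_n = b_n(𝕋) μ(𝕋)^{-n}` gives `r_m · Σ_{n ≤ m} u_n ≤ 1` (the tails `r_k` are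
antitone), and `Σ_{n ≤ m} u_n = 1 + B⁺_m(1/μ) ≥ 1 + ½ log(m/μ)` by (3.1.14) on `𝕋`
(`half_log_le_sum_brickBridgeCount`).
[cite: MadrasSlade1993, eq. (4.2.4)–(4.2.5) (p. 91), Appendix B eq. (B.5), eq. (3.1.14) (p. 62)] -/
theorem brickIrreducibleBridgeTail_le_inv_log {m : ℕ} (hm : 1 ≤ m) (hμm : Real.exp logMuTri ≤ m) :
    1 - ∑ k ∈ Icc 1 m, (brickIrreducibleBridgeCount k : ℝ) / Real.exp logMuTri ^ k ≤
      1 / (1 + Real.log ((m : ℝ) / Real.exp logMuTri) / 2) := by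
  obtain ⟨m', rfl⟩ : ∃ m', m = m' + 1 := ⟨m - 1, by omega⟩
  set μ := Real.exp logMuTri with hμdef
  have hμ : 0 < μ := Real.exp_pos _
  set u : ℕ → ℝ := fun n => (brickBridgeCount n : ℝ) / μ ^ n with hu
  set f : ℕ → ℝ := fun k => (brickIrreducibleBridgeCount k : ℝ) / μ ^ k with hf
  set r : ℕ → ℝ := fun n => 1 - ∑ k ∈ range (n + 1), f k with hrdef
  have hr : ∀ n, r n = 1 - ∑ k ∈ range (n + 1), f k := fun n => rfl
  have hu0 : u 0 = 1 := by simp [hu, brickBridgeCount_zero]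
  have hf0 : f 0 = 0 := by simp [hf, brickIrreducibleBridgeCount_zero]
  have hren : ∀ n, 1 ≤ n → u n = ∑ k ∈ range (n + 1), f k * u (n - k) :=
    fun n hn => brickBridgeCount_div_pow_eq_sum hn
  have hB5 := _root_.Literature.Probability.Process.Renewal.sum_tailSum_mul_eq_one hr hu0 hf0 hren (m' + 1)
  have hf_nonneg : ∀ k, 0 ≤ f k := fun k => by positivity
  have hr_anti : Antitone r := by
    refine antitone_nat_of_succ_le fun n => ?_
    rw [_root_.Literature.Probability.Process.Renewal.tailSum_succ hr n]
    linarith [hf_nonneg (n + 1)]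
  have hu_nonneg : ∀ n, 0 ≤ u n := fun n => by positivity
  have h1 : r (m' + 1) * ∑ k ∈ range (m' + 1 + 1), u (m' + 1 - k) ≤ 1 := by
    rw [← hB5, Finset.mul_sum]
    refine Finset.sum_le_sum fun k hk => ?_
    have hk' : k ≤ m' + 1 := Nat.lt_succ_iff.1 (Finset.mem_range.1 hk)
    exact mul_le_mul_of_nonneg_right (hr_anti hk') (hu_nonneg _)
  have h2 : ∑ k ∈ range (m' + 1 + 1), u (m' + 1 - k) = 1 + triBridgeGFpos (m' + 1) μ⁻¹ := by
    have hrefl : ∑ k ∈ range (m' + 1 + 1), u (m' + 1 - k) = ∑ k ∈ range (m' + 1 + 1), u k := by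
      have := Finset.sum_range_reflect u (m' + 1 + 1)
      simpa using this
    rw [hrefl, triBridgeGFpos, Finset.sum_range_succ',
      Finset.sum_range_succ' (fun n => if n = 0 then (0 : ℝ) else (brickBridgeCount n : ℝ) * μ⁻¹ ^ n)]
    simp only [Nat.succ_ne_zero, if_false, if_true, hu0, add_zero]
    rw [add_comm]
    congr 1
    refine Finset.sum_congr rfl fun n _ => ?_
    simp only [hu, inv_pow, div_eq_mul_inv]
  have h3 : Real.log ((m' + 1 : ℝ) / μ) / 2 ≤ triBridgeGFpos (m' + 1) μ⁻¹ := half_log_le_sum_brickBridgeCount m'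
  have hlog0 : 0 ≤ Real.log (((m' + 1 : ℕ) : ℝ) / μ) := by
    refine Real.log_nonneg ?_
    rw [le_div_iff₀ hμ, one_mul]; exact hμm
  have hm1 : ((m' + 1 : ℕ) : ℝ) = (m' : ℝ) + 1 := by push_cast; ring
  rw [hm1] at hlog0 ⊢
  have hU : 1 + Real.log (((m' : ℝ) + 1) / μ) / 2 ≤ ∑ k ∈ range (m' + 1 + 1), u (m' + 1 - k) := by
    rw [h2]; linarith
  have hUpos : 0 < 1 + Real.log (((m' : ℝ) + 1) / μ) / 2 := by linarith
  have hrm : r (m' + 1) = 1 - ∑ k ∈ Icc 1 (m' + 1), f k := by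
    rw [hr, Finset.sum_range_succ', hf0, add_zero, sum_Icc_one_eq_sum_range_tri]
  rw [← hrm, le_div_iff₀ hUpos]
  calc r (m' + 1) * (1 + Real.log (((m' : ℝ) + 1) / μ) / 2)
      ≤ r (m' + 1) * ∑ k ∈ range (m' + 1 + 1), u (m' + 1 - k) := by
        refine mul_le_mul_of_nonneg_left hU ?_
        rw [hr]
        have := sum_brickIrreducibleBridgeCount_div_pow_le_one (range (m' + 1 + 1))
        linarith
    _ ≤ 1 := h1

/-- **Probabilistic reading**: by Kesten's relation on `𝕋` (`Σ_k λ_k(𝕋) μ(𝕋)^{-k} = 1`) the left side of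
`brickIrreducibleBridgeTail_le_inv_log` is the tail `Σ_{k > m} λ_k(𝕋) μ(𝕋)^{-k}` of the law `λ_k μ^{-k}` on
irreducible bridges, i.e. `P_iSAB(|γ| > m)`. [cite: MadrasSlade1993, §4.2, eq. (4.2.4) and the sentence after it (p. 91)] -/
theorem brickIrreducibleBridgeTail_eq_tsum (m : ℕ) :
    1 - ∑ k ∈ Icc 1 m, (brickIrreducibleBridgeCount k : ℝ) / Real.exp logMuTri ^ k =
      ∑' k, if m < k then (brickIrreducibleBridgeCount k : ℝ) / Real.exp logMuTri ^ k else 0 := by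
  have hsum := summable_brickIrreducibleBridgeCount_div_pow
  have htot := tsum_brickIrreducibleBridgeCount_div_pow
  -- split the full series at `m`: `Σ' = Σ_{k ≤ m} + Σ'_{k > m}`
  have hsplit := (Summable.sum_add_tsum_compl (s := Finset.range (m + 1)) hsum)
  have hrange : ∑ k ∈ Finset.range (m + 1), (brickIrreducibleBridgeCount k : ℝ) / Real.exp logMuTri ^ k =
      ∑ k ∈ Icc 1 m, (brickIrreducibleBridgeCount k : ℝ) / Real.exp logMuTri ^ k := by
    rw [Finset.sum_range_succ', brickIrreducibleBridgeCount_zero, Nat.cast_zero, zero_div, add_zero,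
      sum_Icc_one_eq_sum_range_tri]
  have hcompl : ∑' k : ↥((↑(Finset.range (m + 1)) : Set ℕ)ᶜ),
      (brickIrreducibleBridgeCount k : ℝ) / Real.exp logMuTri ^ (k : ℕ)
      = ∑' k, if m < k then (brickIrreducibleBridgeCount k : ℝ) / Real.exp logMuTri ^ k else 0 := by
    rw [tsum_subtype (((Finset.range (m + 1) : Finset ℕ) : Set ℕ)ᶜ)
      (fun k => (brickIrreducibleBridgeCount k : ℝ) / Real.exp logMuTri ^ k)]
    refine tsum_congr fun k => ?_
    by_cases hk : m < k
    · rw [if_pos hk, Set.indicator_of_mem]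
      simp only [Set.mem_compl_iff, Finset.mem_coe, Finset.mem_range, not_lt]; omega
    · rw [if_neg hk, Set.indicator_of_notMem]
      simp only [Set.mem_compl_iff, Finset.mem_coe, Finset.mem_range, not_lt, not_le]; omega
  rw [← hcompl, ← hrange]
  linarith [hsplit, htot]

/-- **Tail bound in closed form**: `P_iSAB^𝕋(|γ| > m) = Σ_{k > m} λ_k(𝕋) μ(𝕋)^{-k} ≤ 2/(2 + log(m/μ(𝕋)))` for
`m ≥ μ(𝕋)` (e.g. for every `m ≥ 5`, since `μ(𝕋) ≤ 4.271`). [cite: MadrasSlade1993, eq. (4.2.4)–(4.2.5) (p. 91), Appendix B eq. (B.5), eq. (3.1.14) (p. 62)] -/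
theorem tsum_brickIrreducibleBridgeTail_le {m : ℕ} (hm : 1 ≤ m) (hμm : Real.exp logMuTri ≤ m) :
    ∑' k, (if m < k then (brickIrreducibleBridgeCount k : ℝ) / Real.exp logMuTri ^ k else 0) ≤
      2 / (2 + Real.log ((m : ℝ) / Real.exp logMuTri)) := by
  rw [← brickIrreducibleBridgeTail_eq_tsum]
  have h := brickIrreducibleBridgeTail_le_inv_log hm hμm
  have hlog0 : 0 ≤ Real.log ((m : ℝ) / Real.exp logMuTri) :=
    Real.log_nonneg ((le_div_iff₀ (Real.exp_pos _)).2 (by rw [one_mul]; exact hμm))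
  have e : 1 / (1 + Real.log ((m : ℝ) / Real.exp logMuTri) / 2) = 2 / (2 + Real.log ((m : ℝ) / Real.exp logMuTri)) := by
    field_simp
  linarith [e]

end Literature.Probability.RandomPlanarGeometry.SAW

end
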